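import Mathlib.LinearAlgebra.Dual.Lemmas
import Literature.NumberTheory.Automorphic.GKModules
import HarnessLib

/-!
# Finite-dimensional differentiable representations are `(𝔤, K)`-modules

Topic `NumberTheory/Automorphic`; namespace `Literature.NumberTheory.Automorphic.RealMatrixGroup`.
One definition (a `Prop`-valued structure with body) and theorems; no named fact, no `sorry`.

For the tree's linear real groups `G : RealMatrixGroup A N` (`RealMatrixGroups`) and its
`(𝔤, K)`-module axioms `IsGKModule G ρK ρ𝔤` (`GKModules`):

* `RealMatrixGroup.IsDifferentiableRep G τ dτ` — a representation `τ` of `G` on a complex vector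
  space `E` is *(weakly) differentiable with differential* `dτ : 𝔤 →ₗ⁅ℝ⁆ End E`: the matrix
  coefficients `g ↦ ℓ (τ g v)` are continuous and `t ↦ ℓ (τ (exp tX) v)` has derivative
  `ℓ (dτ X v)` at `t = 0` for every `X ∈ 𝔤` [cite: BorelWallach2000, 0 §2.3–2.5];
* `RealMatrixGroup.conj_expMem(_smul)` — `g (exp tX) g⁻¹ = exp (t Ad g X)` in `G`
  (Mathlib's `Matrix.exp_units_conj`);
* `IsDifferentiableRep.conj_dτ` — **`Ad`-compatibility is automatic**:
  `τ(g) ∘ dτ(X) ∘ τ(g)⁻¹ = dτ(Ad g X)` for all `g ∈ G` (differentiate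
  `τ(g exp(tX) g⁻¹) v = τ(exp(t Ad g X)) v` at `0`; functionals separate points);
* `IsDifferentiableRep.isGKModule` — **a finite-dimensional differentiable representation,
  restricted to `K` (`RealMatrixGroup.restrictK`) and with its differential, is a
  `(𝔤, K)`-module** (`IsGKModule`) [cite: BorelWallach2000, 0 §2.4–2.5] — the coefficient
  systems `E` of `H^q(𝔤, K; V ⊗ E)` [cite: BorelWallach2000, I §5.1].

## Mathlib / Literature search

Mathlib has no `(𝔤, K)`-modules; `Matrix.exp_units_conj`, `HasDerivAt.unique`,
`Module.forall_dual_apply_eq_zero_iff` are used. The tree's `isGKModule_harishChandra`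
(`GKModules`, Banach representations, smooth `K`-finite vectors) is the infinite-dimensional
analogue; nothing here duplicates it (`lean search 'IsDifferentiableRep|conj_expMem'`: no hits).

## References

* A. Borel, N. Wallach (2000), 0 §2.3–2.5, I §5.1 (held) [BorelWallach2000].
-/

noncomputable section

namespace Literature.NumberTheory.Automorphic

open Module

-- Mathlib idiom (as in `GKModules`): commutator bracket on `Module.End`
attribute [local instance 100] LieRing.ofAssociativeRing

open scoped MatrixGroups Matrix

variable {A : Type*} [NormedCommRing A] [NormedAlgebra ℝ A] [NormedAlgebra ℚ A] [CompleteSpace A]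
  [StarRing A] {N : Type*} [Fintype N] [DecidableEq N] (G : RealMatrixGroup A N)
  {E : Type*} [AddCommGroup E] [Module ℂ E]
  (τ : Representation ℂ G.carrier E) (dτ : G.lie →ₗ⁅ℝ⁆ Module.End ℂ E)

namespace RealMatrixGroup

/-- `g (exp X) g⁻¹ = exp (Ad g X)` in `G` (Mathlib `Matrix.exp_units_conj`). Knapp, I.§10,
Prop. 1.89. [folklore] -/
theorem conj_expMem (g : G.carrier) (X : G.lie) :
    g * G.expMem X * g⁻¹ = G.expMem (G.Ad g X) := by
  refine Subtype.ext (Units.ext ?_)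
  simp only [Subgroup.coe_mul, Subgroup.coe_inv, Units.val_mul, coe_expMem, coe_expGL,
    Ad_apply_coe]
  exact (Matrix.exp_units_conj (g : GL N A) (X : Matrix N N A)).symm

/-- `g (exp tX) g⁻¹ = exp (t Ad g X)` in `G`. Knapp, I.§10, Prop. 1.89. [folklore] -/
theorem conj_expMem_smul (g : G.carrier) (X : G.lie) (t : ℝ) :
    g * G.expMem (t • X) * g⁻¹ = G.expMem (t • G.Ad g X) := by
  rw [conj_expMem, map_smul]

variable [StarModule ℝ A] [ContinuousStar A]

/-- `exp` on `𝔨` followed by `K ≤ G` is `exp` on `𝔤`. [folklore] -/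
theorem inclusion_expK_smul (X : G.compactLie) (t : ℝ) :
    Subgroup.inclusion G.maximalCompact_le_carrier (G.expK (t • X)) =
      G.expMem (t • LieSubalgebra.inclusion G.compactLie_le_lie X) := rfl

/-- **A differentiable representation** of the linear real group `G` on a complex vector space
`E`, with differential `dτ : 𝔤 → End E`: the matrix coefficients `g ↦ ℓ (τ g v)` are continuous
and `t ↦ ℓ (τ (exp tX) v)` has derivative `ℓ (dτ X v)` at `t = 0` for every `X ∈ 𝔤`.
[cite: BorelWallach2000, 0 §2.3–2.5] -/
structure IsDifferentiableRep : Prop where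
  /-- The matrix coefficients are continuous on `G`. -/
  continuous_coeff : ∀ (v : E) (ℓ : Dual ℂ E), Continuous fun g : G.carrier ↦ ℓ (τ g v)
  /-- `dτ` is the weak differential of `τ` along every `X ∈ 𝔤`. -/
  hasDerivAt_coeff : ∀ (X : G.lie) (v : E) (ℓ : Dual ℂ E),
    HasDerivAt (fun t : ℝ ↦ ℓ (τ (G.expMem (t • X)) v)) (ℓ (dτ X v)) 0

/-- The restriction of a representation of `G` to `K`. [folklore] -/
abbrev restrictK : Representation ℂ G.maximalCompact E :=
  τ.comp (Subgroup.inclusion G.maximalCompact_le_carrier)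

omit [StarModule ℝ A] [ContinuousStar A] in
/-- Unfolding. [folklore] -/
theorem restrictK_apply (k : G.maximalCompact) :
    restrictK G τ k = τ (Subgroup.inclusion G.maximalCompact_le_carrier k) := rfl

namespace IsDifferentiableRep

variable {G τ dτ}

omit [StarModule ℝ A] [ContinuousStar A] in
/-- **`Ad`-compatibility is automatic**: `τ(g) dτ(X) τ(g)⁻¹ = dτ(Ad g X)` — differentiate
`τ(g exp(tX) g⁻¹) = τ(exp (t Ad g X))` at `t = 0` (functionals separate points).
[cite: BorelWallach2000, 0 §2.5 1)] -/
theorem conj_dτ (h : IsDifferentiableRep G τ dτ) (g : G.carrier) (X : G.lie) :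
    τ g ∘ₗ dτ X ∘ₗ τ g⁻¹ = dτ (G.Ad g X) := by
  refine LinearMap.ext fun v => ?_
  simp only [LinearMap.coe_comp, Function.comp_apply]
  rw [← sub_eq_zero, ← forall_dual_apply_eq_zero_iff ℂ]
  intro ℓ
  rw [map_sub, sub_eq_zero]
  have h1 := h.hasDerivAt_coeff X (τ g⁻¹ v) (ℓ ∘ₗ τ g)
  have h2 := h.hasDerivAt_coeff (G.Ad g X) v ℓ
  have heq : (fun t : ℝ ↦ (ℓ ∘ₗ τ g) (τ (G.expMem (t • X)) (τ g⁻¹ v))) =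
      fun t : ℝ ↦ ℓ (τ (G.expMem (t • G.Ad g X)) v) := by
    funext t
    rw [← conj_expMem_smul, map_mul, map_mul, LinearMap.coe_comp, Function.comp_apply,
      Module.End.mul_apply, Module.End.mul_apply]
  rw [heq] at h1
  exact h1.unique h2

/-- **Finite-dimensional differentiable representations are `(𝔤, K)`-modules**: restricting `τ`
to `K` and keeping `dτ` gives an `IsGKModule` (all vectors are `K`-finite; weak continuity and
the weak derivative along `𝔨` are the hypotheses restricted to `K`, `𝔨`; `Ad`-compatibility is
`conj_dτ`). [cite: BorelWallach2000, 0 §2.4–2.5] -/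
theorem isGKModule [FiniteDimensional ℂ E] (h : IsDifferentiableRep G τ dτ) :
    IsGKModule G (restrictK G τ) dτ where
  kFinite _ := inferInstance
  weaklyContinuous v ℓ :=
    (h.continuous_coeff v ℓ).comp (continuous_induced_rng.mpr continuous_subtype_val)
  ad_compat k X := h.conj_dτ (Subgroup.inclusion G.maximalCompact_le_carrier k) X
  hasWeakDeriv X v ℓ := h.hasDerivAt_coeff (LieSubalgebra.inclusion G.compactLie_le_lie X) v ℓ

end IsDifferentiableRep

end RealMatrixGroup

end Literature.NumberTheory.Automorphic
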